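import Summits.ValiantsHypothesis.ValiantsHypothesis.Theorems.SymPencilPerFourOneRowPoint
import Summits.ValiantsHypothesis.ValiantsHypothesis.Theorems.SymPencilPerFourToricPairs
import Mathlib.FieldTheory.IsAlgClosed.Basic

/-!
# Route `SymPencil` — the one-row kernel kill on the COORDINATE hyperplane `w₃ = 0`
# (the toric sub-case of the cell `(13, 3, 0)` of `sdc(per_4)`, abstract form; `--supports`
# stmt-ValiantsHypothesis-5674, rung currency only, nothing here bears on `VP ≠ VNP`)

Abstract linear algebra over an algebraically closed field of characteristic `0`.  DATA: the
kernel package of a symmetric affine determinantal representation of `per_4` read at every base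
point of the kernel space (as in `SymPencilPerFourOneRowPoint`), the row embeddings `embV`, `embX`
with `per_4 (embV w + s · embX x) = s³ per [w; x]`, the kernel rows `embV w` for EVERY `w` with
`w₃ = 0` (with the kernel invariance `CL(embV w) D⁻¹ (im bL) ⊆ im bL` at each of them), and `im bL`
spanned by `bL (embX ·)` and one vector `bL (embV w₀)`.

**Theorem** (`false_of_oneRow_toric`): these data do not exist.  With `u = D⁻¹ bL(embX x)` and a
linear section write `CL(embV e_k) u = bL (embX (K_k x)) + c_k(x) bL(embV w₀)`; for `w₃ = 0` the
pencil identity (`SymPencilPerFourOneRowPoint.pencil_identity`) reads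
`det (D + t CL(embV w)) · Φ_w(x) = κ per [w; x + t (w₀K₀ + w₁K₁ + w₂K₂) x]`; over an algebraically
closed field the invertibility of every `D + CL(t · embV w)` makes `det (D + t CL(embV w))`
CONSTANT, so the pencil `w₀K₀ + w₁K₁ + w₂K₂` stabilises `per [w; ·]` for every `w` with `w₃ = 0`
and is therefore ZERO (`SymPencilPerFourToricPairs.toric_pencil_eq_zero`: column supports from the
Marcus–May rigidity of `per_3`, then the permanental-minor syzygy); at `w = e₀` the `t⁰`
coefficient then factors `per [e₀; ·]` as `linear × quadratic`, excluded by
`SymPencilPerFourRowNoLinearFactor.permanent_rows_ne_linear_mul_quadratic`. [folklore]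
-/

noncomputable section

-- single-conjunct layout: Sub = Summit, duplicated namespace component intended
set_option linter.dupNamespace false

namespace Summit.ValiantsHypothesis.ValiantsHypothesis.Theorems.SymPencilPerFourOneRowToric

open Matrix Module Polynomial MvPolynomial
open Literature.Computability.AlgebraicComplexity
open Summit.ValiantsHypothesis.ValiantsHypothesis.Theorems.SymPencilHomogeneousDropTools
open Summit.ValiantsHypothesis.ValiantsHypothesis.Theorems.SymPencilLagrangianKernel
open Summit.ValiantsHypothesis.ValiantsHypothesis.Theorems.SymPencilPerFourRowForms
open Summit.ValiantsHypothesis.ValiantsHypothesis.Theorems.SymPencilPerFourOneRowPoint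
open Summit.ValiantsHypothesis.ValiantsHypothesis.Theorems.SymPencilPerFourRowNoLinearFactor
open Summit.ValiantsHypothesis.ValiantsHypothesis.Theorems.SymPencilPerFourToricPairs

universe u

variable {K : Type u} [Field K] [CharZero K] {ι' : Type*} [Fintype ι'] [DecidableEq ι']

omit [CharZero K] in
/-- **Determinant constancy along the kernel over an algebraically closed field**: if every
`D + CL(t · v)` is invertible then `det (D + t · CL v) = det D`. [folklore] -/
theorem det_add_smul_eq [IsAlgClosed K] {D : Matrix ι' ι' K}
    (CL : (Fin 4 × Fin 4 → K) →ₗ[K] Matrix ι' ι' K) (v : Fin 4 × Fin 4 → K)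
    (hN : ∀ t : K, IsUnit (D + CL (t • v)).det) (t : K) :
    (D + t • CL v).det = D.det := by
  set δ : K[X] := (D.map Polynomial.C + (Polynomial.X : K[X]) • (CL v).map Polynomial.C).det
    with hδ
  have hdeg : δ.degree = 0 := by
    by_contra hne
    obtain ⟨t₀, ht₀⟩ := IsAlgClosed.exists_root δ hne
    rw [Polynomial.IsRoot.def, hδ, eval_detLine] at ht₀
    have h := hN t₀
    rw [map_smul] at h
    exact h.ne_zero ht₀
  have h1 : δ = Polynomial.C D.det := by
    rw [Polynomial.eq_C_of_degree_eq_zero hdeg, hδ, coeff_detLine_zero]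
  have h2 := congrArg (Polynomial.eval t) h1
  rwa [hδ, eval_detLine, Polynomial.eval_C] at h2

/-- **No toric one-row kernel** (coordinate hyperplane `w₃ = 0`).  See the module docstring.
[folklore] -/
theorem false_of_oneRow_toric [IsAlgClosed K] {D : Matrix ι' ι' K} (hD : IsUnit D.det)
    (hDs : Dᵀ = D)
    (bL : (Fin 4 × Fin 4 → K) →ₗ[K] (ι' → K))
    (CL : (Fin 4 × Fin 4 → K) →ₗ[K] Matrix ι' ι' K) (hCs : ∀ z, (CL z)ᵀ = CL z)
    {κ : K} (hκ : κ ≠ 0)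
    (hii : ∀ z, bL z ⬝ᵥ (D⁻¹ * CL z * D⁻¹) *ᵥ bL z = 0)
    (hN : ∀ v, bL v = 0 → IsUnit (D + CL v).det ∧ ∀ (z : Fin 4 × Fin 4 → K) (s : K),
      κ * MvPolynomial.eval (v + s • z) (perPoly (Fin 4) K) =
        (Matrix.fromBlocks ((s * 0) • (1 : Matrix Unit Unit K))
          (Matrix.replicateRow Unit (s • bL z)) (Matrix.replicateCol Unit (s • bL z))
          (D + CL v + s • CL z)).det)
    (embV : (Fin 4 → K) →ₗ[K] (Fin 4 × Fin 4 → K))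
    (embX : (Fin 3 → Fin 4 → K) →ₗ[K] (Fin 4 × Fin 4 → K))
    (w₀ : Fin 4 → K) (hH : ∀ w : Fin 4 → K, w 3 = 0 → bL (embV w) = 0)
    (hEXr : ∀ z, ∃ (x : Fin 3 → Fin 4 → K) (c : K), bL (embX x) + c • bL (embV w₀) = bL z)
    (hinv : ∀ w : Fin 4 → K, w 3 = 0 → ∀ y ∈ LinearMap.range bL,
      CL (embV w) *ᵥ (D⁻¹ *ᵥ y) ∈ LinearMap.range bL)
    (hper : ∀ (w' : Fin 4 → K) (x : Fin 3 → Fin 4 → K) (s : K),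
      MvPolynomial.eval (embV w' + s • embX x) (perPoly (Fin 4) K) =
        s ^ 3 * (Matrix.of ![w', x 0, x 1, x 2]).permanent) :
    False := by
  classical
  have hD0 : D.det ≠ 0 := hD.ne_zero
  let uL : (Fin 3 → Fin 4 → K) →ₗ[K] (ι' → K) := (D⁻¹).mulVecLin ∘ₗ bL ∘ₗ embX
  have hu : ∀ x, uL x = D⁻¹ *ᵥ bL (embX x) := fun x => rfl
  -- a linear section of `(x, c) ↦ bL (embX x) + c • n` onto `im bL`
  set n : ι' → K := bL (embV w₀) with hn
  have hmemΨ : ∀ p : (Fin 3 → Fin 4 → K) × K,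
      ((bL ∘ₗ embX).coprod (LinearMap.toSpanSingleton K (ι' → K) n)) p ∈ LinearMap.range bL := by
    intro p
    refine ⟨embX p.1 + p.2 • embV w₀, ?_⟩
    rw [LinearMap.coprod_apply, LinearMap.comp_apply, LinearMap.toSpanSingleton_apply, map_add,
      map_smul]
  let Ψ : ((Fin 3 → Fin 4 → K) × K) →ₗ[K] LinearMap.range bL :=
    LinearMap.codRestrict (LinearMap.range bL) _ hmemΨ
  have hΨ : ∀ p : (Fin 3 → Fin 4 → K) × K, (Ψ p : ι' → K) = bL (embX p.1) + p.2 • n := fun p => by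
    show ((bL ∘ₗ embX).coprod (LinearMap.toSpanSingleton K (ι' → K) n)) p = _
    rw [LinearMap.coprod_apply, LinearMap.comp_apply, LinearMap.toSpanSingleton_apply]
  have hΨsurj : LinearMap.range Ψ = ⊤ := by
    rw [LinearMap.range_eq_top]
    rintro ⟨y, z, rfl⟩
    obtain ⟨x, c, hxc⟩ := hEXr z
    exact ⟨(x, c), Subtype.ext (by rw [hΨ]; exact hxc)⟩
  obtain ⟨σ, hσ⟩ := Ψ.exists_rightInverse_of_surjective hΨsurj
  -- the maps `K_k, c_k` at the kernel rows `e_k`, `k = 0, 1, 2`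
  have hmk : ∀ k : Fin 4, (Pi.single k 1 : Fin 4 → K) 3 = 0 →
      ∃ (Kk : (Fin 3 → Fin 4 → K) →ₗ[K] (Fin 3 → Fin 4 → K)) (ck : (Fin 3 → Fin 4 → K) →ₗ[K] K),
        ∀ x, bL (embX (Kk x)) + ck x • n =
          CL (embV (Pi.single k 1)) *ᵥ (D⁻¹ *ᵥ bL (embX x)) := by
    intro k hk
    let g : (Fin 3 → Fin 4 → K) →ₗ[K] LinearMap.range bL :=
      LinearMap.codRestrict (LinearMap.range bL) ((CL (embV (Pi.single k 1))).mulVecLin ∘ₗ uL)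
        fun x => hinv _ hk _ (LinearMap.mem_range_self bL (embX x))
    have hg : ∀ x, (g x : ι' → K) = CL (embV (Pi.single k 1)) *ᵥ uL x := fun x => rfl
    refine ⟨LinearMap.fst K _ _ ∘ₗ σ ∘ₗ g, LinearMap.snd K _ _ ∘ₗ σ ∘ₗ g, fun x => ?_⟩
    have h1 : ((Ψ.comp σ) (g x) : ι' → K) = (g x : ι' → K) := by rw [hσ, LinearMap.id_apply]
    rw [LinearMap.comp_apply, hΨ, hg] at h1
    exact h1
  obtain ⟨K₀, c₀, hK₀⟩ := hmk 0 (by simp)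
  obtain ⟨K₁, c₁, hK₁⟩ := hmk 1 (by simp)
  obtain ⟨K₂, c₂, hK₂⟩ := hmk 2 (by simp)
  -- the pencil at a general kernel row `w`, `w₃ = 0`
  have hKw : ∀ w : Fin 4 → K, w 3 = 0 → ∀ x,
      bL (embX ((w 0 • K₀ + w 1 • K₁ + w 2 • K₂) x)) + (w 0 • c₀ + w 1 • c₁ + w 2 • c₂) x • n =
        CL (embV w) *ᵥ (D⁻¹ *ᵥ bL (embX x)) := by
    intro w hw x
    have hw' : w = w 0 • (Pi.single 0 1 : Fin 4 → K) + w 1 • Pi.single 1 1 + w 2 • Pi.single 2 1 := by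
      funext i
      fin_cases i <;> simp [hw]
    conv_rhs => rw [hw']
    simp only [LinearMap.add_apply, LinearMap.smul_apply, map_add, map_smul, Matrix.add_mulVec,
      Matrix.smul_mulVec, smul_eq_mul, add_smul]
    rw [← hK₀, ← hK₁, ← hK₂]
    simp only [smul_add, smul_smul, mul_comm (w 0), mul_comm (w 1), mul_comm (w 2)]
    abel
  have hI : ∀ w : Fin 4 → K, w 3 = 0 → ∀ (x : Fin 3 → Fin 4 → K) (t : K),
      (Matrix.of ![w, (x + t • (w 0 • K₀ x + w 1 • K₁ x + w 2 • K₂ x)) 0,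
        (x + t • (w 0 • K₀ x + w 1 • K₁ x + w 2 • K₂ x)) 1,
        (x + t • (w 0 • K₀ x + w 1 • K₁ x + w 2 • K₂ x)) 2]).permanent =
      (Matrix.of ![w, x 0, x 1, x 2]).permanent := by
    intro w hw x t
    have hmain := pencil_identity hD hDs bL CL hCs hii hN embV embX hper w w₀ (hH w hw)
      (w 0 • K₀ + w 1 • K₁ + w 2 • K₂) (w 0 • c₀ + w 1 • c₁ + w 2 • c₂) (hKw w hw)
    have hK0 := (pencil_coeffs _ _ hmain x).1
    have h := hmain x t
    have hdet : (D + t • CL (embV w)).det = D.det :=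
      det_add_smul_eq CL (embV w) (fun s => (hN (s • embV w) (by rw [map_smul, hH w hw,
        smul_zero])).1) t
    rw [hdet, ← mul_assoc, mul_comm D.det t, mul_assoc, hK0, ← mul_assoc, mul_comm t κ] at h
    by_cases ht : t = 0
    · subst ht; simp
    · have h' := mul_left_cancel₀ (mul_ne_zero hκ ht) h
      simp only [LinearMap.add_apply, LinearMap.smul_apply] at h'
      exact h'.symm
  obtain ⟨hK₀0, -, -⟩ := toric_pencil_eq_zero K₀ K₁ K₂ hI
  -- at `w = e₀`: `per [e₀; ·] = linear × quadratic`, absurd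
  set e₀ : Fin 4 → K := Pi.single 0 1 with he₀
  have he₀3 : e₀ 3 = 0 := by simp [he₀]
  have hmain := pencil_identity hD hDs bL CL hCs hii hN embV embX hper e₀ w₀ (hH e₀ he₀3)
    K₀ c₀ hK₀
  let Bq : (Fin 3 → Fin 4 → K) →ₗ[K] (Fin 3 → Fin 4 → K) →ₗ[K] K :=
    (Matrix.toLinearMap₂' K (CL (embV w₀))).compl₁₂ uL uL
  have hBq : ∀ x y, Bq x y = uL x ⬝ᵥ CL (embV w₀) *ᵥ uL y := fun x y => by
    simp only [Bq, LinearMap.compl₁₂_apply, Matrix.toLinearMap₂'_apply']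
  refine permanent_rows_ne_linear_mul_quadratic (w := e₀)
    (Function.ne_iff.2 ⟨0, by simp [he₀]⟩) ((D.det / κ) • c₀) Bq fun x => ?_
  have h := (pencil_coeffs _ _ hmain x).1
  rw [hK₀0, LinearMap.zero_apply, map_zero, zero_add, map_smul, Matrix.smul_mulVec,
    dotProduct_smul, smul_eq_mul, ← hu, ← hBq] at h
  rw [LinearMap.smul_apply, smul_eq_mul, div_mul_eq_mul_div, div_mul_eq_mul_div, eq_div_iff hκ]
  linear_combination -h

end Summit.ValiantsHypothesis.ValiantsHypothesis.Theorems.SymPencilPerFourOneRowToric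

end
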